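import Literature.Geometry.Lorentzian.AsymptoticallyFlatChart
import HarnessLib

/-!
# Patching an initial data set beyond a sphere of an asymptotically flat end

Plumbing for gluing constructions (topic `Geometry/Lorentzian`; the construction is explicit and
everything about it is PROVED). Let `e : AFEnd X` be an end of the `3`-manifold `X`, `D = (h, k)`
an initial data set on `X`, `R ≤ R₁ < R₂`, and `(hᵀ, kᵀ)` a pair of fields of bilinear forms on the
tangent spaces of `X` which on the far region `e.far R₁ = {R₁ < ‖coord‖}` are smooth, symmetric,
`hᵀ` positive definite, and which AGREE with `(h, k)` on the coordinate annulus
`{R₁ < ‖coord‖ < R₂}`. Then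

  `(e.patch D …).h = hᵀ` on `e.far R₁`,  `= h` elsewhere   (same for `k`)

is an initial data set on the SAME manifold `X` (`AFEnd.patch`): near a point of `far R₁` its
sections are those of `(hᵀ, kᵀ)`, and near a point outside the closed far set
`e.closedFar R' = {R' ≤ ‖coord‖}` (`R₁ < R' ≤ R₂`) they are those of `D`, because on
`far R₁ ∖ closedFar R'` the two prescriptions agree; the two open sets cover `X`
(`patch_eventuallyEq_far`, `patch_eventuallyEq_of_not_mem_closedFar`). This is the bookkeeping
step "replace the data beyond a large coordinate sphere and keep them inside" of every
exterior / annular gluing construction (Corvino 2000, §4; Corvino–Schoen 2006; Bartnik 1986, §1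
for the sets `E_R`), isolated from any analysis: what the new far sections are, and why they
solve the constraints, is the user's business (the constraint functions at `x` only see the germ
of the data at `x`).

* `AFEnd.closedFar e R'` — the closed far set `{q ∈ U | R' ≤ ‖coord q‖}` (closed in `X` for
  `R' > R`, `AFEnd.isClosed_far`), with `far R' ⊆ closedFar R' ⊆ far R₁` for `R₁ < R'`;
* `AFEnd.patch` and its section lemmas `patch_h_inner_of_mem`, `patch_k_of_mem`,
  `patch_h_inner_of_not_mem`, `patch_k_of_not_mem`, `patch_h_inner_of_not_mem_closedFar`,
  `patch_k_of_not_mem_closedFar`, the germ lemmas above, and `patch_eq_of_not_mem_far`.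

## References

* J. Corvino, *Scalar curvature deformation and a gluing construction for the Einstein
  constraint equations*, Comm. Math. Phys. 214 (2000), §4. [Corvino2000]
* R. Bartnik, *The mass of an asymptotically flat manifold*, CPAM 39 (1986), §1. [Bartnik1986]
-/

noncomputable section

open Bundle Set Filter TopologicalSpace
open scoped Manifold ContDiff Topology

namespace Literature.Geometry.Lorentzian

namespace AFEnd

variable {X : Type} [TopologicalSpace X] [ChartedSpace E3 X] (e : AFEnd X)

/-! ### The closed far sets -/

/-- The **closed far set** `{q ∈ U | R' ≤ ‖coord q‖}` of the end (the set `chart⁻¹ {R' ≤ ‖x‖}`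
whose closedness in `X` is the axiom `AFEnd.isClosed_far`). Bartnik 1986, §1. [cite: Bartnik1986, §1] -/
def closedFar (R' : ℝ) : Set X := {q | ∃ _ : q ∈ e.U, R' ≤ ‖e.coord q‖}

variable {R' : ℝ}

/-- Membership in the closed far set. [cite: Bartnik1986, §1] -/
theorem mem_closedFar_iff {q : X} : q ∈ e.closedFar R' ↔ ∃ _ : q ∈ e.U, R' ≤ ‖e.coord q‖ := Iff.rfl

/-- The closed far set is the image set of `AFEnd.isClosed_far`. [cite: Bartnik1986, §1] -/
theorem closedFar_eq_image (R' : ℝ) :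
    e.closedFar R' = ((↑) : e.U → X) '' (e.chart ⁻¹' {x | R' ≤ ‖(x : E3)‖}) := by
  ext q
  rw [e.mem_closedFar_iff]
  constructor
  · rintro ⟨hq, hR⟩
    refine ⟨⟨q, hq⟩, ?_, rfl⟩
    show R' ≤ ‖(e.chart ⟨q, hq⟩ : E3)‖
    rwa [← e.coord_of_mem hq]
  · rintro ⟨q', hq', rfl⟩
    refine ⟨q'.2, ?_⟩
    rw [e.coord_of_mem q'.2]
    exact hq'

/-- **The closed far sets are closed in `X`** (for `R' > R`). [cite: Bartnik1986, §1] -/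
theorem isClosed_closedFar (hR' : e.R < R') : IsClosed (e.closedFar R') := by
  rw [e.closedFar_eq_image]
  exact e.isClosed_far R' hR'

/-- `far R' ⊆ closedFar R'`. [cite: Bartnik1986, §1] -/
theorem far_subset_closedFar (R' : ℝ) : e.far R' ⊆ e.closedFar R' := fun _ hq ↦ by
  obtain ⟨hq, hlt⟩ := e.mem_far_iff_coord.1 hq
  exact ⟨hq, hlt.le⟩

/-- `closedFar R' ⊆ far R₁` for `R₁ < R'`. [cite: Bartnik1986, §1] -/
theorem closedFar_subset_far {R₁ : ℝ} (h : R₁ < R') : e.closedFar R' ⊆ e.far R₁ := fun _ hq ↦ by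
  obtain ⟨hq, hle⟩ := hq
  exact e.mem_far_iff_coord.2 ⟨hq, lt_of_lt_of_le h hle⟩

/-- A point of the end outside `closedFar R'` has coordinate norm `< R'`. [cite: Bartnik1986, §1] -/
theorem norm_coord_lt_of_not_mem_closedFar {q : X} (hq : q ∈ e.U) (h : q ∉ e.closedFar R') :
    ‖e.coord q‖ < R' := by
  by_contra hle
  exact h ⟨hq, not_lt.1 hle⟩

/-- A point outside `far R₁` (with `R₁ < R'`) is outside `closedFar R'`. [cite: Bartnik1986, §1] -/
theorem notMem_closedFar_of_notMem_far {R₁ : ℝ} (h : R₁ < R') {q : X} (hq : q ∉ e.far R₁) :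
    q ∉ e.closedFar R' := fun h' ↦ hq (e.closedFar_subset_far h h')

/-! ### The patched initial data set -/

/-- Bilinear-form-valued fields on the tangent spaces of `X` (the type of `D.h.inner` and `D.k`).
[folklore] -/
abbrev BilinField (X : Type) [TopologicalSpace X] [ChartedSpace E3 X] : Type :=
  Π x : X, TangentSpace (𝓡 3) x →L[ℝ] TangentSpace (𝓡 3) x →L[ℝ] ℝ

section Patch

variable [IsManifold (𝓡 3) ∞ X]

/-- Smoothness of a bilinear-form-valued field on a set, as a section of the bundle
`Hom(TX, Hom(TX, ℝ))` (the `ContMDiffOn` form of `InitialDataSet.contMDiff_k`). [folklore] -/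
def SmoothBilinOn (s : BilinField X) (W : Set X) : Prop :=
  ContMDiffOn (𝓡 3) ((𝓡 3).prod 𝓘(ℝ, E3 →L[ℝ] E3 →L[ℝ] ℝ)) ∞
    (fun x : X ↦ TotalSpace.mk' (E3 →L[ℝ] E3 →L[ℝ] ℝ)
      (E := fun x : X ↦ TangentSpace (𝓡 3) x →L[ℝ] TangentSpace (𝓡 3) x →L[ℝ] ℝ) x (s x)) W

/-- **The hypotheses of the patching construction**: new far sections `(hᵀ, kᵀ)` which on
`e.far R₁` are smooth, symmetric, `hᵀ` positive definite, and which agree with `D` on the annulus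
`{R₁ < ‖coord‖ < R₂}`; and `R ≤ R₁ < R₂`. [cite: Corvino2000, §4] -/
structure PatchData (D : InitialDataSet (𝓡 3) X) (R₁ R₂ : ℝ) (hT kT : BilinField X) : Prop where
  R_le : e.R ≤ R₁
  lt : R₁ < R₂
  smooth_h : SmoothBilinOn hT (e.far R₁)
  smooth_k : SmoothBilinOn kT (e.far R₁)
  symm_h : ∀ x ∈ e.far R₁, ∀ v w, hT x v w = hT x w v
  pos_h : ∀ x ∈ e.far R₁, ∀ v, v ≠ 0 → 0 < hT x v v
  symm_k : ∀ x ∈ e.far R₁, ∀ v w, kT x v w = kT x w v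
  agree_h : ∀ x ∈ e.far R₁, ‖e.coord x‖ < R₂ → hT x = D.h.inner x
  agree_k : ∀ x ∈ e.far R₁, ‖e.coord x‖ < R₂ → kT x = D.k x

variable {e} {D : InitialDataSet (𝓡 3) X} {R₁ R₂ : ℝ} {hT kT : BilinField X}

open scoped Classical in
/-- The patched field: `sT` on `far R₁`, `s` elsewhere. [folklore] -/
def patchField (e : AFEnd X) (R₁ : ℝ) (sT s : BilinField X) : BilinField X :=
  fun x ↦ if x ∈ e.far R₁ then sT x else s x

omit [IsManifold (𝓡 3) ∞ X] in
/-- On `far R₁` the patched field is the new field. [folklore] -/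
theorem patchField_of_mem {sT s : BilinField X} {x : X} (hx : x ∈ e.far R₁) :
    patchField e R₁ sT s x = sT x := by
  classical
  exact if_pos hx

omit [IsManifold (𝓡 3) ∞ X] in
/-- Off `far R₁` the patched field is the old field. [folklore] -/
theorem patchField_of_not_mem {sT s : BilinField X} {x : X} (hx : x ∉ e.far R₁) :
    patchField e R₁ sT s x = s x := by
  classical
  exact if_neg hx

omit [IsManifold (𝓡 3) ∞ X] in
/-- Near a point of `far R₁` the patched field is the new field. [folklore] -/
theorem patchField_eventuallyEq_of_mem {sT s : BilinField X} {x : X} (hx : x ∈ e.far R₁) :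
    ∀ᶠ y in 𝓝 x, patchField e R₁ sT s y = sT y := by
  filter_upwards [(e.isOpen_far R₁).mem_nhds hx] with y hy
  exact patchField_of_mem hy

omit [IsManifold (𝓡 3) ∞ X] in
/-- **Near a point outside `closedFar R'` (`R < R'`, `R' ≤ R₂`) the patched field is the OLD
field**, provided the two fields agree on `far R₁ ∩ {‖coord‖ < R₂}`. [cite: Corvino2000, §4] -/
theorem patchField_eventuallyEq_of_not_mem_closedFar {sT s : BilinField X} {R' : ℝ}
    (hR : e.R < R') (hR₂ : R' ≤ R₂)
    (hagree : ∀ y ∈ e.far R₁, ‖e.coord y‖ < R₂ → sT y = s y) {x : X} (hx : x ∉ e.closedFar R') :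
    ∀ᶠ y in 𝓝 x, patchField e R₁ sT s y = s y := by
  filter_upwards [(e.isClosed_closedFar hR).isOpen_compl.mem_nhds hx] with y hy
  by_cases hyf : y ∈ e.far R₁
  · rw [patchField_of_mem hyf]
    have hyU : y ∈ e.U := e.far_subset R₁ hyf
    exact hagree y hyf (lt_of_lt_of_le (e.norm_coord_lt_of_not_mem_closedFar hyU hy) hR₂)
  · exact patchField_of_not_mem hyf

/-- **The patched field is smooth** when the new field is smooth on `far R₁`, the old one is
smooth, and they agree on the annulus (`R ≤ R₁ < R₂`): every point has a neighbourhood on which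
the patched field is one of the two. [cite: Corvino2000, §4] -/
theorem contMDiff_patchField {sT s : BilinField X} (hR₁ : e.R ≤ R₁) (hlt : R₁ < R₂)
    (hsT : SmoothBilinOn sT (e.far R₁))
    (hs : ContMDiff (𝓡 3) ((𝓡 3).prod 𝓘(ℝ, E3 →L[ℝ] E3 →L[ℝ] ℝ)) ∞
      (fun x : X ↦ TotalSpace.mk' (E3 →L[ℝ] E3 →L[ℝ] ℝ)
        (E := fun x : X ↦ TangentSpace (𝓡 3) x →L[ℝ] TangentSpace (𝓡 3) x →L[ℝ] ℝ) x (s x)))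
    (hagree : ∀ y ∈ e.far R₁, ‖e.coord y‖ < R₂ → sT y = s y) :
    ContMDiff (𝓡 3) ((𝓡 3).prod 𝓘(ℝ, E3 →L[ℝ] E3 →L[ℝ] ℝ)) ∞
      (fun x : X ↦ TotalSpace.mk' (E3 →L[ℝ] E3 →L[ℝ] ℝ)
        (E := fun x : X ↦ TangentSpace (𝓡 3) x →L[ℝ] TangentSpace (𝓡 3) x →L[ℝ] ℝ) x
        (patchField e R₁ sT s x)) := by
  intro x
  by_cases hx : x ∈ e.far R₁
  · refine (hsT.contMDiffAt ((e.isOpen_far R₁).mem_nhds hx)).congr_of_eventuallyEq ?_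
    filter_upwards [patchField_eventuallyEq_of_mem (sT := sT) (s := s) hx] with y hy
    rw [hy]
  · -- `x ∉ closedFar R'` for `R' = (R₁ + R₂)/2`
    have hR' : e.R < (R₁ + R₂) / 2 := by linarith
    have hx' : x ∉ e.closedFar ((R₁ + R₂) / 2) :=
      e.notMem_closedFar_of_notMem_far (by linarith) hx
    refine (hs x).congr_of_eventuallyEq ?_
    filter_upwards [patchField_eventuallyEq_of_not_mem_closedFar (sT := sT) (s := s) hR'
      (by linarith) hagree hx'] with y hy
    rw [hy]

/-- **The patched initial data set** `e.patch D P`: sections `(hᵀ, kᵀ)` on `e.far R₁` and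
`(h, k)` elsewhere, for patch data `P : e.PatchData D R₁ R₂ hᵀ kᵀ`. Corvino 2000, §4 (the glued
metric equals the original inside and the new one outside a large sphere).
[cite: Corvino2000, §4] -/
def patch (e : AFEnd X) (D : InitialDataSet (𝓡 3) X) {R₁ R₂ : ℝ} {hT kT : BilinField X}
    (P : e.PatchData D R₁ R₂ hT kT) : InitialDataSet (𝓡 3) X where
  h :=
    { inner := patchField e R₁ hT D.h.inner
      symm := fun x v w ↦ by
        by_cases hx : x ∈ e.far R₁
        · rw [patchField_of_mem hx]
          exact P.symm_h x hx v w
        · rw [patchField_of_not_mem hx]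
          exact D.h.symm x v w
      pos := fun x v hv ↦ by
        by_cases hx : x ∈ e.far R₁
        · rw [patchField_of_mem hx]
          exact P.pos_h x hx v hv
        · rw [patchField_of_not_mem hx]
          exact D.h.pos x v hv
      isVonNBounded := fun x ↦ by
        by_cases hx : x ∈ e.far R₁
        · have h := PseudoRiemannianMetric.IsSpacelikeImmersion.isVonNBounded_setOf_lt_one_of_pos
            (V := E3) (show E3 →L[ℝ] E3 →L[ℝ] ℝ from hT x) (P.pos_h x hx)
          simp only [patchField_of_mem hx]
          exact h
        · simp only [patchField_of_not_mem hx]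
          exact D.h.isVonNBounded x
      contMDiff := contMDiff_patchField P.R_le P.lt P.smooth_h D.h.contMDiff P.agree_h }
  k := patchField e R₁ kT D.k
  k_symm x v w := by
    by_cases hx : x ∈ e.far R₁
    · rw [patchField_of_mem hx]
      exact P.symm_k x hx v w
    · rw [patchField_of_not_mem hx]
      exact D.k_symm x v w
  contMDiff_k := contMDiff_patchField P.R_le P.lt P.smooth_k D.contMDiff_k P.agree_k

variable (P : e.PatchData D R₁ R₂ hT kT)

/-- The metric of the patch on `far R₁` is `hᵀ`. [cite: Corvino2000, §4] -/
theorem patch_h_inner_of_mem {x : X} (hx : x ∈ e.far R₁) : (e.patch D P).h.inner x = hT x :=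
  patchField_of_mem hx

/-- The tensor `k` of the patch on `far R₁` is `kᵀ`. [cite: Corvino2000, §4] -/
theorem patch_k_of_mem {x : X} (hx : x ∈ e.far R₁) : (e.patch D P).k x = kT x :=
  patchField_of_mem hx

/-- The metric of the patch off `far R₁` is `h`. [cite: Corvino2000, §4] -/
theorem patch_h_inner_of_not_mem {x : X} (hx : x ∉ e.far R₁) :
    (e.patch D P).h.inner x = D.h.inner x :=
  patchField_of_not_mem hx

/-- The tensor `k` of the patch off `far R₁` is `k`. [cite: Corvino2000, §4] -/
theorem patch_k_of_not_mem {x : X} (hx : x ∉ e.far R₁) : (e.patch D P).k x = D.k x :=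
  patchField_of_not_mem hx

/-- **The patch agrees with `D` outside the closed far set `closedFar R₂`** (there the new and old
sections coincide where both are used). [cite: Corvino2000, §4] -/
theorem patch_h_inner_of_not_mem_closedFar {x : X} (hx : x ∉ e.closedFar R₂) :
    (e.patch D P).h.inner x = D.h.inner x := by
  by_cases hxf : x ∈ e.far R₁
  · rw [patch_h_inner_of_mem P hxf]
    exact P.agree_h x hxf (e.norm_coord_lt_of_not_mem_closedFar (e.far_subset R₁ hxf) hx)
  · exact patch_h_inner_of_not_mem P hxf

/-- The tensor `k` of the patch agrees with `k` outside `closedFar R₂`. [cite: Corvino2000, §4] -/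
theorem patch_k_of_not_mem_closedFar {x : X} (hx : x ∉ e.closedFar R₂) :
    (e.patch D P).k x = D.k x := by
  by_cases hxf : x ∈ e.far R₁
  · rw [patch_k_of_mem P hxf]
    exact P.agree_k x hxf (e.norm_coord_lt_of_not_mem_closedFar (e.far_subset R₁ hxf) hx)
  · exact patch_k_of_not_mem P hxf

/-- **Germ of the patch at a point of `far R₁`**: its sections are those of `(hᵀ, kᵀ)` near `x`.
[cite: Corvino2000, §4] -/
theorem patch_eventuallyEq_far {x : X} (hx : x ∈ e.far R₁) :
    (∀ᶠ y in 𝓝 x, (e.patch D P).h.inner y = hT y) ∧ ∀ᶠ y in 𝓝 x, (e.patch D P).k y = kT y :=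
  ⟨patchField_eventuallyEq_of_mem hx, patchField_eventuallyEq_of_mem hx⟩

/-- **Germ of the patch outside `closedFar R'`** (`R < R'`, `R' ≤ R₂`): its sections are those of
`D` near `x`. In particular this holds near every point outside `far R₁` (take `R' ∈ (R₁, R₂]`).
[cite: Corvino2000, §4] -/
theorem patch_eventuallyEq_of_not_mem_closedFar {R' : ℝ} (hR : e.R < R') (hR₂ : R' ≤ R₂) {x : X}
    (hx : x ∉ e.closedFar R') :
    (∀ᶠ y in 𝓝 x, (e.patch D P).h.inner y = D.h.inner y) ∧
      ∀ᶠ y in 𝓝 x, (e.patch D P).k y = D.k y :=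
  ⟨patchField_eventuallyEq_of_not_mem_closedFar hR hR₂ P.agree_h hx,
    patchField_eventuallyEq_of_not_mem_closedFar hR hR₂ P.agree_k hx⟩

/-- Germ of the patch at a point outside `far R₁`: its sections are those of `D` near `x`.
[cite: Corvino2000, §4] -/
theorem patch_eventuallyEq_of_not_mem_far {x : X} (hx : x ∉ e.far R₁) :
    (∀ᶠ y in 𝓝 x, (e.patch D P).h.inner y = D.h.inner y) ∧
      ∀ᶠ y in 𝓝 x, (e.patch D P).k y = D.k y := by
  have hR' : e.R < (R₁ + R₂) / 2 := by linarith [P.R_le, P.lt]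
  exact patch_eventuallyEq_of_not_mem_closedFar P hR' (by linarith [P.lt])
    (e.notMem_closedFar_of_notMem_far (by linarith [P.lt]) hx)

/-- **The patch agrees with `D` off `far R₁`** (as sections: metric and `k`). [cite: Corvino2000, §4] -/
theorem patch_eq_of_not_mem_far {x : X} (hx : x ∉ e.far R₁) :
    (e.patch D P).h.inner x = D.h.inner x ∧ (e.patch D P).k x = D.k x :=
  ⟨patch_h_inner_of_not_mem P hx, patch_k_of_not_mem P hx⟩

end Patch

end AFEnd

end Literature.Geometry.Lorentzian

end
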